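import Summits.QuantumFields.YangMills.Theorems.PencilRigidityDiagonalMirrorRPRReduction

/-!
# Line `parity-bridge-cold-traces` — crux `DiagonalMirrorRPR` (stmt-QuantumFields-10604) — RESHAPED skeleton (lead a1)

Skeleton of record for the crux shared verbatim by `Theses/PencilRigidity.lean` (#5) and
`Theses/MirrorModularBoosts.lean` (#4):

  for every compact simple `G`, `r`, `sch`, one-species family `S₁` with the curvature package
  `W₁ r sch S₁` (`CurvaturePackage`), `S₁` is reflection positive in pull-back form in the four
  diagonal frames `R e₀ = (±e₀ ± e₁)/√2` (`DiagonalFrameRP`).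

**Reshape by the second lead (2026-08-16, unit `line-stmt-QuantumFields-10604-a1`).**  The first lead's line died at its
transport LEVER (`stub_schemeColdness`: cold slice traces — false for `π₁(G) ≠ 0`, unprovable from `W₁`), see
`Lines/parity-bridge-cold-traces.dead.md`.  What the line PROVED is lever-free and landed: S1 `stub_fortyFiveSwapRP`
(exact swap-RP of Wilson's measure on the FILS 45° torus, p90603 + Literature p86530) and S4' `stub_rpClosureOffDiag`
(OS-limit closure from cover insensitivity on off-diagonal compact real families, p94527).  This reshape keeps the
composition `S1 + transport + S4' (+ scope)` and collapses the transport layer (old S2 + S3') into the ONE statement the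
closure actually consumes, with no intermediate lever:

* `stub_coverTransportOffDiag` — `CurvaturePackage r sch S₁ → (∀ᶠ k, 0 ≤ β_k) → CoverInsensitivityOffDiag r sch`:
  the curvature strings of pairwise-disjoint compactly supported real families computed on the statement's odd torus
  `ℤ⁴/N_kℤ⁴` and on its 45° double cover agree in the limit.  THIS is the honest residual of the crux (finite-size /
  boundary-condition transport at physical scale along an arbitrary gapped Wilson scheme); it is not supplied by `W₁`
  (which has no clause comparing two finite volumes at the same `k`) and is not a theorem in print beyond strong coupling.
* `stub_frequentlyNegativeCoupling` — the crux on schemes with `β_k < 0` for infinitely many `k` (scope; no lever exists;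
  vacuous once the planners add `∀ᶠ k in atTop, 0 ≤ sch.β k` to `W₁`, as the disprover, all triagers and both leads
  recommend).

The composition is LANDED: `Theorems/PencilRigidityDiagonalMirrorRPRReduction.lean` (p96361) —
`Reduction.diagonalFrameRP_of_coverInsensitivityOffDiag` (shift the scheme past its last negative coupling; the package
and cover insensitivity are tail-invariant; S1 on every cover; close with S4'), `Reduction.DiagonalMirrorRPR_of_coverTransport`
= the registered sub-goal `stub_reduction_coverTransport` (transport ∧ scope ⇒ crux), and the closing theorem of the
RECOMMENDED RESTATEMENT `Reduction.diagonalFrameRP_of_coverConvergence` (`W₁` + `∀ᶠ k, 0 ≤ β_k` + lattice convergence on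
the 45° covers ⇒ `DiagonalFrameRP`, proved outright).  `DiagonalMirrorRPR_proof` below is that composition applied to the
two sorried stubs.

Disproof items honoured: `Negative/HconvLoadBearing` (`hconv` is used in all degrees inside S4'); `Negative/SquareTorusNotSwapRP`
(no square-torus RP is asserted; S1 is the 45° torus, `N ≥ 2`); Disproof §5(a) (β ≥ 0 explicit; negative couplings isolated
in the scope stub); §7(b) (comparison partner boundaryless, same `β_k`); §9 (action-specific Schur cut, inside S1).
-/

noncomputable section

open scoped SchwartzMap ComplexConjugate
open MeasureTheory Filter Topology
open Literature.MathematicalPhysics.QuantumLattice Literature.MathematicalPhysics.AQFT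
  Literature.MathematicalPhysics.QuantumFieldTheory

namespace Summit.QuantumFields.YangMills.Cruxes.DiagonalMirrorRPR.ParityBridgeColdTraces

/-! ## §0 Readback of the crux (vocabulary imported VERBATIM from `Theorems/PencilRigidityDiagonalMirrorRPRStubRpClosureDefs.lean`
and `…StubRpClosureOffDiag.lean`: `CurvaturePackage`, `DiagonalFrameRP`, `CoverSwapRPAt`, `coverSchwinger`,
`CoverInsensitivityOffDiag`, `RPClosureOffDiag`) -/

/-- Readback: the crux is definitionally `∀ G simple, r, sch, S₁: CurvaturePackage → DiagonalFrameRP`. -/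
theorem crux_iff :
    Summit.QuantumFields.YangMills.Theses.PencilRigidity.DiagonalMirrorRPR ↔
      ∀ (G : Type) [Group G] [TopologicalSpace G] [IsTopologicalGroup G] [CompactSpace G],
        IsCompactSimpleLieGroup G →
          letI : MeasurableSpace G := borel G
          haveI : BorelSpace G := ⟨rfl⟩
          ∀ (r : LatticeRep G) (sch : SpeciesScheme (YMSpecies G)) (S₁ : SchwingerFamily E4),
            CurvaturePackage r sch S₁ → DiagonalFrameRP S₁ :=
  Iff.rfl

/-- The two route copies are the same proposition. -/
theorem shared_verbatim :
    Summit.QuantumFields.YangMills.Theses.PencilRigidity.DiagonalMirrorRPR ↔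
      Summit.QuantumFields.YangMills.Theses.MirrorModularBoosts.DiagonalMirrorRPR := Iff.rfl

/-! ## §1 The registered stubs -/

/-- Statement of `stub_coverTransportOffDiag` (the transport residual of the crux). -/
def CoverTransportOffDiag : Prop :=
  ∀ (G : Type) [Group G] [TopologicalSpace G] [IsTopologicalGroup G] [CompactSpace G]
    [MeasurableSpace G] [BorelSpace G], IsCompactSimpleLieGroup G →
    ∀ (r : LatticeRep G) (sch : SpeciesScheme (YMSpecies G)) (S₁ : SchwingerFamily E4),
      CurvaturePackage r sch S₁ → (∀ᶠ k in atTop, 0 ≤ sch.β k) → CoverInsensitivityOffDiag r sch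

/-- Statement of `stub_frequentlyNegativeCoupling` (scope stub). -/
def FrequentlyNegativeCouplingScope : Prop :=
  ∀ (G : Type) [Group G] [TopologicalSpace G] [IsTopologicalGroup G] [CompactSpace G]
    [MeasurableSpace G] [BorelSpace G], IsCompactSimpleLieGroup G →
    ∀ (r : LatticeRep G) (sch : SpeciesScheme (YMSpecies G)) (S₁ : SchwingerFamily E4),
      CurvaturePackage r sch S₁ → (∃ᶠ k in atTop, sch.β k < 0) → DiagonalFrameRP S₁

/-! `stub_fortyFiveSwapRP` (S1): LANDED (`…StubFortyFiveSwapRP`). `stub_rpClosureOffDiag` (S4'): LANDED (`…StubRpClosureOffDiag`).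
`stub_reduction_coverTransport` (composition): LANDED (`…Reduction`, p96361). -/

/-- **Transport stub (the crux's honest residual; NOT exported by `W₁`).** Along a package-carrying scheme whose
couplings are eventually non-negative, the curvature strings of pairwise-disjoint compactly supported real families
computed on the statement's odd torus `ℤ⁴/N_kℤ⁴` (`N_k = 2L_k+1`) and on its FILS 45° double cover
`ℤ⁴/⟨N_k(e₀+e₁), N_k(e₀−e₁), N_ke₂, N_ke₃⟩` have difference `→ 0`.  Physics: both are boundaryless volumes of physical
size `≍ ℓ_k = a_k N_k → ∞` at the same coupling, in a phase that clusters uniformly (`HasLatticeMassGap`), so local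
expectations should agree up to `O(e^{−Δℓ_k})`; no proof from `W₁` is known (no clause of `W₁` compares two finite
volumes at the same `k`; coldness / twist-weight / unique-bulk levers all need an extra thermodynamic input). -/
theorem stub_coverTransportOffDiag :
    ∀ (G : Type) [Group G] [TopologicalSpace G] [IsTopologicalGroup G] [CompactSpace G]
      [MeasurableSpace G] [BorelSpace G], IsCompactSimpleLieGroup G →
      ∀ (r : LatticeRep G) (sch : SpeciesScheme (YMSpecies G)) (S₁ : SchwingerFamily E4),
        CurvaturePackage r sch S₁ → (∀ᶠ k in atTop, 0 ≤ sch.β k) → CoverInsensitivityOffDiag r sch := by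
  sorry

/-- **Scope stub (outside every lever).** Schemes with `β_k < 0` for infinitely many `k`: the diagonal Schur cut is
not cone-positive for `β < 0` (`Disproof` §5(a)); `β_k → −∞` is positive coupling with the maximal 't Hooft twist for
`SU(2)` on the odd tori (`Negative/OddTorusTwist`) and an uncontrolled frustrated model otherwise.  Recommended
crux-level repair: add `∀ᶠ k in atTop, 0 ≤ sch.β k` to `W₁`, which makes this stub vacuous. -/
theorem stub_frequentlyNegativeCoupling :
    ∀ (G : Type) [Group G] [TopologicalSpace G] [IsTopologicalGroup G] [CompactSpace G]
      [MeasurableSpace G] [BorelSpace G], IsCompactSimpleLieGroup G →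
      ∀ (r : LatticeRep G) (sch : SpeciesScheme (YMSpecies G)) (S₁ : SchwingerFamily E4),
        CurvaturePackage r sch S₁ → (∃ᶠ k in atTop, sch.β k < 0) → DiagonalFrameRP S₁ := by
  sorry

/-! ## §2 Composition (kernel-checked, no `sorry`; the landed `Reduction.stub_reduction_coverTransport`) -/

/-- **The line concludes the crux** (transport ∧ scope ⇒ the `PencilRigidity` copy). -/
theorem DiagonalMirrorRPR_of :
    CoverTransportOffDiag → FrequentlyNegativeCouplingScope →
      Summit.QuantumFields.YangMills.Theses.PencilRigidity.DiagonalMirrorRPR :=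
  fun hT hS => shared_verbatim.mpr (Reduction.stub_reduction_coverTransport hT hS)

/-- **Skeleton theorem** (hypothesis-free: the landed composition applied to the registered stubs; it becomes the crux
proof when the last stub is discharged).  It concludes the item's recorded decl, the `MirrorModularBoosts` copy of the
crux (shared VERBATIM with the `PencilRigidity` copy, `shared_verbatim`). -/
theorem DiagonalMirrorRPR_proof :
    Summit.QuantumFields.YangMills.Theses.MirrorModularBoosts.DiagonalMirrorRPR :=
  Reduction.stub_reduction_coverTransport stub_coverTransportOffDiag stub_frequentlyNegativeCoupling

end Summit.QuantumFields.YangMills.Cruxes.DiagonalMirrorRPR.ParityBridgeColdTraces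

end
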